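import Mathlib.LinearAlgebra.Matrix.SpecialLinearGroup
import Literature.Computability.AlgebraicComplexity.OrbitClosure
import HarnessLib

/-!
# Polystable forms; `det_n` and `per_n` are polystable (Bürgisser–Ikenmeyer 2017, Cor. 2.9)

P. Bürgisser, C. Ikenmeyer, *Fundamental invariants of orbit closures*, J. Algebra **477** (2017)
390–434 [BurgisserIkenmeyer2017] (arXiv:1511.02927, §2.2 read):

* **Definition 2.7.** *A form `w ∈ Sym^D ℂ^m` is called polystable iff the `SL_m`-orbit of `w` is
  closed.*
* **Proposition 2.8** (Hilbert–Mumford refined by Luna/Kempf): if some reductive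
  `R ≤ SL_m ∩ stab(w)` has its `SL_m`-centraliser inside the diagonal matrices and the convex cone
  of `supp(w)` contains `(1, …, 1)`, then `w` is polystable.
* **Corollary 2.9.** *The forms `X₁⋯X_m`, `X₁^D + ⋯ + X_m^D` if `D > 1`, `det_n`, and `per_n` are
  all polystable* (for `det_n`, `per_n`: `R` = diagonal torus of `SL_{n²}`, support = permutation
  matrices, whose cyclic shifts sum to the all-ones matrix).

This file defines the `SL`-orbit `slOrbit f` of a polynomial under linear substitution of
variables (`linSubst`, `LinSubst.lean`) and the predicate `IsPolystable f` — the coefficient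
vectors of the `SL`-orbit form a Zariski-closed subset of coefficient space (`zariskiClosure`,
`coeffVec` of `OrbitClosure.lean`) — and vendors the `det_n` / `per_n` clauses of Cor. 2.9 as the
named fact `BurgisserIkenmeyer2017_polystable_det_per`, with the projection to the verbatim
hypothesis (i) of route item `Summit.ValiantsHypothesis.…UnpaddedGIT.Completeness` proved
(`.perPoly_closure_subset`).

## Rendering notes

* Coefficient space is the tree's `(σ →₀ ℕ) → k` (ALL monomials, `OrbitClosure.lean` design). For
  a form `f` of degree `D` the orbit lies in the Zariski-closed coordinate subspace of vectors
  supported in degree `D`, and a subset of that subspace is closed there iff it is closed in the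
  finite-dimensional `Sym^D` (a polynomial vanishing on the subset restricts to one in the
  degree-`D` coordinates), so "the `SL_m`-orbit of `w` is closed in `Sym^D ℂ^m`" is exactly
  `IsPolystable w` (Zariski = Euclidean closure for orbits, Mulmuley–Sohoni §4.1).
* `SL_m` acts through `linSubst σ k ↑g` (`X_i ↦ ∑_j g_{ji} X_j`); the orbit as a set does not
  depend on the side/transposition convention (it is a group orbit).
* Only the `det_n`, `per_n` clauses of Cor. 2.9 are vendored (the two other families are omitted —
  a sub-statement of the printed corollary).

## References

* [BurgisserIkenmeyer2017] P. Bürgisser, C. Ikenmeyer, *Fundamental invariants of orbit closures*,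
  J. Algebra 477 (2017) 390–434; arXiv:1511.02927: Def. 2.7, Prop. 2.8, Cor. 2.9 (§2.2).
* K. Mulmuley, M. Sohoni, *Geometric complexity theory I*, SIAM J. Comput. 31 (2001), §4.1.
  [MulmuleySohoni2001]
-/

noncomputable section

open MvPolynomial

namespace Literature.Computability.AlgebraicComplexity

section SLOrbit

variable (σ k : Type*) [Fintype σ] [DecidableEq σ] [CommRing k]

/-- The `SL σ k`-orbit `SL · f` of a polynomial under linear substitution of variables
(`linSubst`), as a set. Written as the set-builder term inlined by route `UnpaddedGIT`
(`Completeness`, hypothesis (i)). Bürgisser–Ikenmeyer 2017, §2.2. [cite: BurgisserIkenmeyer2017, Def. 2.7 (§2.2)] -/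
def slOrbit (f : MvPolynomial σ k) : Set (MvPolynomial σ k) :=
  {h : MvPolynomial σ k | ∃ g : Matrix.SpecialLinearGroup σ k, h = linSubst σ k (g : Matrix σ σ k) f}

variable {σ k}

/-- Membership in the `SL`-orbit, unfolded. [folklore] -/
theorem mem_slOrbit_iff (f h : MvPolynomial σ k) :
    h ∈ slOrbit σ k f ↔ ∃ g : Matrix.SpecialLinearGroup σ k, h = linSubst σ k (g : Matrix σ σ k) f :=
  Iff.rfl

/-- `f` lies in its own `SL`-orbit (`g = 1`). [folklore] -/
theorem mem_slOrbit_self (f : MvPolynomial σ k) : f ∈ slOrbit σ k f := by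
  refine ⟨1, ?_⟩
  rw [Matrix.SpecialLinearGroup.coe_one]
  have h : linSubst σ k (1 : Matrix σ σ k) = AlgHom.id k _ := by
    have := map_one (linSubstMonoidHom σ k)
    exact this
  rw [h, AlgHom.id_apply]

end SLOrbit

section Polystable

variable {σ k : Type*} [Fintype σ] [DecidableEq σ] [Field k]

/-- The `SL`-orbit is contained in the `GL`-orbit. [folklore] -/
theorem slOrbit_subset_glOrbit (f : MvPolynomial σ k) : slOrbit σ k f ⊆ glOrbit σ k f := by
  rintro h ⟨g, rfl⟩
  exact ⟨Matrix.SpecialLinearGroup.toGL g, rfl⟩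

/-- **Polystability** (Bürgisser–Ikenmeyer 2017, Def. 2.7: *a form `w ∈ Sym^D ℂ^m` is called
polystable iff the `SL_m`-orbit of `w` is closed*): the set of coefficient vectors of the
`SL σ k`-orbit of `f` is Zariski closed in coefficient space `(σ →₀ ℕ) → k` (see the module
docstring for why this is closedness in `Sym^D` when `f` is a form of degree `D`).
[cite: BurgisserIkenmeyer2017, Def. 2.7] -/
def IsPolystable (f : MvPolynomial σ k) : Prop :=
  zariskiClosure (coeffVec '' slOrbit σ k f) ⊆ coeffVec '' slOrbit σ k f

/-- Polystability iff the coefficient image of the `SL`-orbit equals its Zariski closure. [folklore] -/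
theorem isPolystable_iff_zariskiClosure_eq (f : MvPolynomial σ k) :
    IsPolystable f ↔ zariskiClosure (coeffVec '' slOrbit σ k f) = coeffVec '' slOrbit σ k f :=
  ⟨fun h => Set.Subset.antisymm h (subset_zariskiClosure _), fun h => h.le⟩

end Polystable

/-! ### The named fact -/

/-- **Bürgisser–Ikenmeyer 2017, Corollary 2.9 (the `det_n` and `per_n` clauses).** *The forms
`X₁⋯X_m`, `X₁^D + ⋯ + X_m^D` if `D > 1`, `det_n`, and `per_n` are all polystable* — i.e.
(Def. 2.7) their `SL`-orbits are closed; here for the generic determinant `detPoly (Fin n) ℂ` and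
permanent `perPoly (Fin n) ℂ` in the `n²` variables under `SL_{n²}(ℂ) = SL (Fin n × Fin n) ℂ`,
for every `n`. Proof in print: Prop. 2.8 with `R` the diagonal torus of `SL_{n²}` (its centraliser
is diagonal) and `supp(det_n) = supp(per_n)` = the permutation matrices, whose `n` cyclic shifts
sum to the all-ones exponent vector. [cite: BurgisserIkenmeyer2017, Cor. 2.9] -/
def BurgisserIkenmeyer2017_polystable_det_per : Prop :=
  ∀ n : ℕ, IsPolystable (detPoly (Fin n) ℂ) ∧ IsPolystable (perPoly (Fin n) ℂ)

/-- `det_n` is polystable (projection). [cite: BurgisserIkenmeyer2017, Cor. 2.9] -/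
theorem BurgisserIkenmeyer2017_polystable_det_per.isPolystable_detPoly
    (h : BurgisserIkenmeyer2017_polystable_det_per) (n : ℕ) : IsPolystable (detPoly (Fin n) ℂ) :=
  (h n).1

/-- `per_n` is polystable (projection). [cite: BurgisserIkenmeyer2017, Cor. 2.9] -/
theorem BurgisserIkenmeyer2017_polystable_det_per.isPolystable_perPoly
    (h : BurgisserIkenmeyer2017_polystable_det_per) (n : ℕ) : IsPolystable (perPoly (Fin n) ℂ) :=
  (h n).2

/-- **The route's hypothesis (i), verbatim** (`Summit.ValiantsHypothesis.…UnpaddedGIT.Completeness`):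
every point of the Zariski closure of the coefficient vectors of the `SL_{n²}`-orbit of `per_n`
is the coefficient vector of a point of that orbit. [cite: BurgisserIkenmeyer2017, Cor. 2.9] -/
theorem BurgisserIkenmeyer2017_polystable_det_per.perPoly_closure_subset
    (h : BurgisserIkenmeyer2017_polystable_det_per) (n : ℕ) :
    ∀ v : ((Fin n × Fin n) →₀ ℕ) → ℂ,
      v ∈ zariskiClosure (coeffVec '' {h : MvPolynomial (Fin n × Fin n) ℂ |
        ∃ g : Matrix.SpecialLinearGroup (Fin n × Fin n) ℂ,
          h = linSubst (Fin n × Fin n) ℂ (g : Matrix (Fin n × Fin n) (Fin n × Fin n) ℂ)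
            (perPoly (Fin n) ℂ)}) →
      v ∈ coeffVec '' {h : MvPolynomial (Fin n × Fin n) ℂ |
        ∃ g : Matrix.SpecialLinearGroup (Fin n × Fin n) ℂ,
          h = linSubst (Fin n × Fin n) ℂ (g : Matrix (Fin n × Fin n) (Fin n × Fin n) ℂ)
            (perPoly (Fin n) ℂ)} := by
  intro v hv
  have h2 := (h n).2
  unfold IsPolystable slOrbit at h2
  exact h2 hv

/-- The same for `det_n`. [cite: BurgisserIkenmeyer2017, Cor. 2.9] -/
theorem BurgisserIkenmeyer2017_polystable_det_per.detPoly_closure_subset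
    (h : BurgisserIkenmeyer2017_polystable_det_per) (n : ℕ) :
    ∀ v : ((Fin n × Fin n) →₀ ℕ) → ℂ,
      v ∈ zariskiClosure (coeffVec '' {h : MvPolynomial (Fin n × Fin n) ℂ |
        ∃ g : Matrix.SpecialLinearGroup (Fin n × Fin n) ℂ,
          h = linSubst (Fin n × Fin n) ℂ (g : Matrix (Fin n × Fin n) (Fin n × Fin n) ℂ)
            (detPoly (Fin n) ℂ)}) →
      v ∈ coeffVec '' {h : MvPolynomial (Fin n × Fin n) ℂ |
        ∃ g : Matrix.SpecialLinearGroup (Fin n × Fin n) ℂ,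
          h = linSubst (Fin n × Fin n) ℂ (g : Matrix (Fin n × Fin n) (Fin n × Fin n) ℂ)
            (detPoly (Fin n) ℂ)} := by
  intro v hv
  have h1 := (h n).1
  unfold IsPolystable slOrbit at h1
  exact h1 hv

end Literature.Computability.AlgebraicComplexity

end
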